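import Summits.FinalStateConjecture.FinalStateConjecture.Theorems.EIHFluxBalanceInertialRecessionVirialHierarchy
import Summits.FinalStateConjecture.FinalStateConjecture.Theorems.EIHFluxBalanceInertialRecessionVirialDynamics

/-!
# Route EIHFluxBalance — crux `InertialRecession`, abstract endgame for general `N`:
# nodes of the frozen-block hierarchy — transport, levels, singletons, ball supersets, uniform parents

Helper file for the crux `stmt-FinalStateConjecture-10166` (virial route; evidence notes
`InertialRecession_endgame_generalN_virial.md` §3 and `InertialRecession_seat0_session8_note.md` §A). Mathlib-only.

The virial lemma is assembled over a DYADIC FROZEN-BLOCK hierarchy: a set `B` is a level-`ℓ` node during a level-`ℓ` time block iff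
at the block start it is `Λ`-gapped — internal distances `≤ D`, distances to ALL other bodies `≥ g`, `ΛD < g` — with `g ∈ [2^ℓ, 2^{ℓ+3})`.
This file collects the configuration-level facts the assembly needs, all stated for two configurations `ξ, ξ′ : ι → E3` that differ
by at most `μ` per body ("transport" across a block):

* `controlled_transport` — `(D, g)`-control at `ξ` becomes `(D + 2μ, g − 2μ)`-control at `ξ′`;
* `gap_le_diam_of_ssubset` — if `B ⊊ B′` then the gap of `B` is at most the diameter bound of `B′` (supersets live at coarser levels);
* `exists_level_of_two_le` — every `d ≥ 2` has a level `ℓ` with `2^{ℓ+1} ≤ d < 2^{ℓ+2}` (singletons always qualify);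
* `exists_nearest` — a nearest other body exists;
* `exists_ball_ssuperset` — a `Λ`-gapped set with a near outsider has a strict superset (a ball cluster) with internal distances `< 2r`,
  external `≥ (4Λ+1)r`, `4g ≤ r ≤ (4Λ+2)^{|ι|}·4g` (repackaging of `exists_gapped_ssuperset`; this is the lever bound);
* `exists_parentOf` — a parent map depending only on the set of strict supersets (so parents are constant along a block).
-/

noncomputable section

open Finset

namespace Summit.FinalStateConjecture.FinalStateConjecture.Theorems.SublinearIsFree.Virial

open Literature.Geometry.Lorentzian

variable {ι : Type*}

/-! ### Transport across a block -/

/-- Distances change by at most `2μ` when every body moves by at most `μ`. [folklore] -/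
theorem abs_dist_sub_dist_le_of_move {ξ ξ' : ι → E3} {μ : ℝ} (hμ : ∀ x, ‖ξ' x - ξ x‖ ≤ μ) (x y : ι) :
    |‖ξ' x - ξ' y‖ - ‖ξ x - ξ y‖| ≤ 2 * μ := by
  have h := abs_norm_sub_sub_norm_sub_le (ξ' x) (ξ' y) (ξ x) (ξ y)
  linarith [hμ x, hμ y]

/-- **Transport of control.** If `B` has internal distances `≤ D` and external distances `≥ g` in the configuration `ξ`, and every body
moves by at most `μ`, then in `ξ′` it has internal distances `≤ D + 2μ` and external distances `≥ g − 2μ`. [folklore] -/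
theorem controlled_transport [DecidableEq ι] [Fintype ι] {ξ ξ' : ι → E3} {μ : ℝ} (hμ : ∀ x, ‖ξ' x - ξ x‖ ≤ μ)
    {B : Finset ι} {D g : ℝ}
    (hD : ∀ x ∈ B, ∀ y ∈ B, ‖ξ x - ξ y‖ ≤ D) (hg : ∀ x ∈ B, ∀ z ∈ univ \ B, g ≤ ‖ξ x - ξ z‖) :
    (∀ x ∈ B, ∀ y ∈ B, ‖ξ' x - ξ' y‖ ≤ D + 2 * μ) ∧ (∀ x ∈ B, ∀ z ∈ univ \ B, g - 2 * μ ≤ ‖ξ' x - ξ' z‖) := by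
  constructor
  · intro x hx y hy
    have h := abs_dist_sub_dist_le_of_move hμ x y
    rw [abs_le] at h
    linarith [hD x hx y hy]
  · intro x hx z hz
    have h := abs_dist_sub_dist_le_of_move hμ x z
    rw [abs_le] at h
    linarith [hg x hx z hz]

/-- Transport of a near-outsider witness: a cross distance `< W` becomes `< W + 2μ`. [folklore] -/
theorem near_transport {ξ ξ' : ι → E3} {μ : ℝ} (hμ : ∀ x, ‖ξ' x - ξ x‖ ≤ μ) {x₀ z₀ : ι} {W : ℝ}
    (h : ‖ξ x₀ - ξ z₀‖ < W) : ‖ξ' x₀ - ξ' z₀‖ < W + 2 * μ := by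
  have h' := abs_dist_sub_dist_le_of_move hμ x₀ z₀
  rw [abs_le] at h'
  linarith

/-- Composition of two motions (`μ₁` then `μ₂`) is a motion by `μ₁ + μ₂`. [folklore] -/
theorem move_trans {ξ₁ ξ₂ ξ₃ : ι → E3} {μ₁ μ₂ : ℝ} (h₁ : ∀ x, ‖ξ₂ x - ξ₁ x‖ ≤ μ₁) (h₂ : ∀ x, ‖ξ₃ x - ξ₂ x‖ ≤ μ₂) :
    ∀ x, ‖ξ₃ x - ξ₁ x‖ ≤ μ₁ + μ₂ := fun x ↦
  calc ‖ξ₃ x - ξ₁ x‖ = ‖(ξ₃ x - ξ₂ x) + (ξ₂ x - ξ₁ x)‖ := by rw [sub_add_sub_cancel]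
    _ ≤ ‖ξ₃ x - ξ₂ x‖ + ‖ξ₂ x - ξ₁ x‖ := norm_add_le _ _
    _ ≤ μ₁ + μ₂ := by linarith [h₁ x, h₂ x]

/-- A motion bound is symmetric. [folklore] -/
theorem move_symm {ξ ξ' : ι → E3} {μ : ℝ} (h : ∀ x, ‖ξ' x - ξ x‖ ≤ μ) : ∀ x, ‖ξ x - ξ' x‖ ≤ μ := fun x ↦ by
  rw [norm_sub_rev]; exact h x

/-! ### Supersets live at coarser scales -/

/-- If `B ⊊ B′`, the external lower bound `g` of `B` is at most the internal upper bound `D′` of `B′` (some point of `B′ ∖ B` is an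
outsider of `B` inside `B′`). [folklore] -/
theorem gap_le_diam_of_ssubset [DecidableEq ι] [Fintype ι] {ξ : ι → E3} {B B' : Finset ι} {g D' : ℝ} (hBB' : B ⊂ B')
    (hB : B.Nonempty) (hg : ∀ x ∈ B, ∀ z ∈ univ \ B, g ≤ ‖ξ x - ξ z‖) (hD' : ∀ x ∈ B', ∀ y ∈ B', ‖ξ x - ξ y‖ ≤ D') : g ≤ D' := by
  obtain ⟨y, hyB', hyB⟩ := Finset.exists_of_ssubset hBB'
  obtain ⟨x, hx⟩ := hB
  exact (hg x hx y (Finset.mem_sdiff.mpr ⟨Finset.mem_univ _, hyB⟩)).trans (hD' x (hBB'.1 hx) y hyB')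

/-! ### Levels -/

/-- Every `d ≥ 2` has a level `ℓ` with `2^{ℓ+1} ≤ d < 2^{ℓ+2}` (so that after a motion by `≤ 2^ℓ/16` per body the distance still lies
in `[2^ℓ, 2^{ℓ+3})`). [folklore] -/
theorem exists_level_of_two_le {d : ℝ} (hd : 2 ≤ d) : ∃ ℓ : ℕ, (2 : ℝ) ^ (ℓ + 1) ≤ d ∧ d < (2 : ℝ) ^ (ℓ + 2) := by
  obtain ⟨n, hn, hn'⟩ := exists_nat_pow_near (by linarith : (1 : ℝ) ≤ d) (by norm_num : (1 : ℝ) < 2)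
  have hn0 : n ≠ 0 := by
    rintro rfl
    norm_num at hn'
    linarith
  obtain ⟨ℓ, rfl⟩ := Nat.exists_eq_succ_of_ne_zero hn0
  exact ⟨ℓ, hn, hn'⟩

/-- A nearest other body exists (given another body). [folklore] -/
theorem exists_nearest [DecidableEq ι] [Fintype ι] (ξ : ι → E3) (j : ι) (h : (univ.erase j).Nonempty) :
    ∃ z₀ ∈ univ.erase j, ∀ z ∈ univ.erase j, ‖ξ j - ξ z₀‖ ≤ ‖ξ j - ξ z‖ :=
  Finset.exists_min_image _ (fun z ↦ ‖ξ j - ξ z‖) h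

/-- **Singletons are gapped at their level.** With a nearest other body `z₀` at distance `d ≥ 2`, the singleton `{j}` is
`(0, d)`-controlled, its near-outsider witness is `z₀` itself, and `d` has a level. [folklore] -/
theorem singleton_controlled [DecidableEq ι] [Fintype ι] (ξ : ι → E3) (j : ι) {z₀ : ι} (hz₀ : z₀ ∈ univ.erase j)
    (hmin : ∀ z ∈ univ.erase j, ‖ξ j - ξ z₀‖ ≤ ‖ξ j - ξ z‖) :
    (∀ x ∈ ({j} : Finset ι), ∀ y ∈ ({j} : Finset ι), ‖ξ x - ξ y‖ ≤ 0) ∧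
    (∀ x ∈ ({j} : Finset ι), ∀ z ∈ univ \ {j}, ‖ξ j - ξ z₀‖ ≤ ‖ξ x - ξ z‖) ∧
    (z₀ ∈ univ \ ({j} : Finset ι)) := by
  refine ⟨?_, ?_, ?_⟩
  · intro x hx y hy
    rw [Finset.mem_singleton] at hx hy
    subst hx; subst hy
    simp
  · intro x hx z hz
    rw [Finset.mem_singleton] at hx
    subst hx
    have hz' : z ∈ univ.erase x := by
      rw [Finset.mem_sdiff, Finset.mem_singleton] at hz
      exact Finset.mem_erase.mpr ⟨hz.2, hz.1⟩
    exact hmin z hz'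
  · rw [Finset.mem_erase] at hz₀
    rw [Finset.mem_sdiff, Finset.mem_singleton]
    exact ⟨hz₀.2, hz₀.1⟩

/-! ### The lever bound: ball supersets -/

/-- **Ball superset of a gapped set.** Let `B` be `(D, g)`-controlled (external distances to ALL other bodies `≥ g > 0`) and `Λ`-gapped
(`ΛD < g`, `Λ ≥ 1`), nonempty, with an outsider within `2g`. Then some strict superset `Bb` of `B` has internal distances `< 2r` and
external distances `≥ (4Λ+1)r` for a radius `4g ≤ r ≤ (4Λ+2)^{|ι|}·4g`. [folklore] -/
theorem exists_ball_ssuperset [DecidableEq ι] [Fintype ι] {ξ : ι → E3} {B : Finset ι} {D g Λ : ℝ} (hΛ : 1 ≤ Λ)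
    (hB : B.Nonempty) (hD : ∀ x ∈ B, ∀ y ∈ B, ‖ξ x - ξ y‖ ≤ D) (hg0 : 0 < g) (hgap : Λ * D < g)
    (hnear : ∃ x₀ ∈ B, ∃ z₀ ∈ univ \ B, ‖ξ x₀ - ξ z₀‖ < 2 * g) :
    ∃ (Bb : Finset ι) (r : ℝ), B ⊂ Bb ∧ (∀ x ∈ Bb, ∀ y ∈ Bb, ‖ξ x - ξ y‖ < 2 * r) ∧
      (∀ x ∈ Bb, ∀ z ∈ univ \ Bb, (4 * Λ + 1) * r ≤ ‖ξ x - ξ z‖) ∧ 4 * g ≤ r ∧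
      r ≤ (4 * Λ + 2) ^ (Fintype.card ι) * (4 * g) := by
  obtain ⟨j, hj⟩ := hB
  obtain ⟨m, hm, hsub, hnot, hint, hext⟩ :=
    exists_gapped_ssuperset (s := univ) (B := B) (ξ := ξ) hΛ (Finset.subset_univ _) hj hD hg0 hgap hnear
  refine ⟨univ.filter (fun i ↦ ‖ξ i - ξ j‖ < (4 * Λ + 2) ^ m * (4 * g)), (4 * Λ + 2) ^ m * (4 * g),
    Finset.ssubset_iff_subset_ne.mpr ⟨hsub, fun h ↦ hnot (h ▸ Finset.Subset.refl _)⟩, hint, hext, ?_, ?_⟩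
  · have h1 : (1 : ℝ) ≤ (4 * Λ + 2) ^ m := one_le_pow₀ (by linarith)
    nlinarith
  · rw [Finset.card_univ] at hm
    exact mul_le_mul_of_nonneg_right (pow_le_pow_right₀ (by linarith) hm) (by linarith)

/-- Registered one-line form of `exists_ball_ssuperset` (the lever bound of the frozen-block hierarchy). [folklore] -/
theorem exists_ball_ssuperset_of_gapped : open Literature.Geometry.Lorentzian Finset in ∀ {ι : Type*} [DecidableEq ι] [Fintype ι] {ξ : ι → E3} {B : Finset ι} {D g Λ : ℝ}, 1 ≤ Λ → B.Nonempty → (∀ x ∈ B, ∀ y ∈ B, ‖ξ x - ξ y‖ ≤ D) → 0 < g → Λ * D < g → (∃ x₀ ∈ B, ∃ z₀ ∈ univ \ B, ‖ξ x₀ - ξ z₀‖ < 2 * g) → ∃ (Bb : Finset ι) (r : ℝ), B ⊂ Bb ∧ (∀ x ∈ Bb, ∀ y ∈ Bb, ‖ξ x - ξ y‖ < 2 * r) ∧ (∀ x ∈ Bb, ∀ z ∈ univ \ Bb, (4 * Λ + 1) * r ≤ ‖ξ x - ξ z‖) ∧ 4 * g ≤ r ∧ r ≤ (4 * Λ + 2)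 ^ (Fintype.card ι) * (4 * g) :=
  fun hΛ hB hD hg0 hgap hnear ↦ exists_ball_ssuperset hΛ hB hD hg0 hgap hnear

/-! ### Uniform parents -/

/-- **Uniform parent map.** For a fixed root `K` there is ONE map `parOf` assigning to a family `𝒩` and a set `A` a parent
`parOf 𝒩 A`, with the three parent properties whenever `𝒩` is a laminar family of nonempty strict subsets of `K`, and depending on `𝒩`
only through the strict supersets of `A` in `𝒩` (so that along a time block, while the supersets of a node do not change, neither does
its parent). [folklore] -/
theorem exists_parentOf [DecidableEq ι] (K : Finset ι) :
    ∃ parOf : Finset (Finset ι) → Finset ι → Finset ι,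
      (∀ 𝒩 : Finset (Finset ι), (∀ A ∈ 𝒩, ∀ B ∈ 𝒩, (A ∩ B).Nonempty → A ⊆ B ∨ B ⊆ A) → (∀ A ∈ 𝒩, A.Nonempty) →
        (∀ A ∈ 𝒩, A ⊂ K) →
        (∀ A ∈ 𝒩, A ⊂ parOf 𝒩 A) ∧ (∀ A ∈ 𝒩, parOf 𝒩 A ∈ 𝒩 ∨ parOf 𝒩 A = K) ∧
          ∀ A ∈ 𝒩, ∀ B, (B ∈ 𝒩 ∨ B = K) → A ⊂ B → parOf 𝒩 A ⊆ B) ∧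
      ∀ (𝒩 𝒩' : Finset (Finset ι)) (A : Finset ι),
        𝒩.filter (fun B ↦ A ⊂ B) = 𝒩'.filter (fun B ↦ A ⊂ B) → parOf 𝒩 A = parOf 𝒩' A := by
  classical
  -- least-cardinality element of a nonempty family, else the root
  have hmin : ∀ S : Finset (Finset ι), S.Nonempty → ∃ B₀ ∈ S, ∀ B ∈ S, B₀.card ≤ B.card := fun S h ↦
    Finset.exists_min_image _ Finset.card h
  choose! m hm hmle using hmin
  refine ⟨fun 𝒩 A ↦ if (𝒩.filter fun B ↦ A ⊂ B).Nonempty then m (𝒩.filter fun B ↦ A ⊂ B) else K, ?_, ?_⟩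
  · intro 𝒩 hlam hne hsub
    refine ⟨?_, ?_, ?_⟩
    · intro A hA
      dsimp only
      by_cases h : (𝒩.filter fun B ↦ A ⊂ B).Nonempty
      · rw [if_pos h]
        exact (Finset.mem_filter.mp (hm _ h)).2
      · rw [if_neg h]
        exact hsub A hA
    · intro A _
      dsimp only
      by_cases h : (𝒩.filter fun B ↦ A ⊂ B).Nonempty
      · rw [if_pos h]
        exact Or.inl (Finset.mem_filter.mp (hm _ h)).1
      · rw [if_neg h]
        exact Or.inr rfl
    · intro A hA B hB hAB
      dsimp only
      rcases hB with hB | rfl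
      · have h : (𝒩.filter fun B ↦ A ⊂ B).Nonempty := ⟨B, Finset.mem_filter.mpr ⟨hB, hAB⟩⟩
        rw [if_pos h]
        have hm𝒩 : m (𝒩.filter fun B ↦ A ⊂ B) ∈ 𝒩 := (Finset.mem_filter.mp (hm _ h)).1
        have hAm : A ⊂ m (𝒩.filter fun B ↦ A ⊂ B) := (Finset.mem_filter.mp (hm _ h)).2
        have hmeet : (m (𝒩.filter fun B ↦ A ⊂ B) ∩ B).Nonempty := by
          obtain ⟨x, hx⟩ := hne A hA
          exact ⟨x, Finset.mem_inter.mpr ⟨hAm.1 hx, hAB.1 hx⟩⟩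
        rcases hlam _ hm𝒩 _ hB hmeet with h1 | h1
        · exact h1
        · have hle := hmle _ h B (Finset.mem_filter.mpr ⟨hB, hAB⟩)
          exact (Finset.eq_of_subset_of_card_le h1 hle).symm.subset
      · by_cases h : (𝒩.filter fun B ↦ A ⊂ B).Nonempty
        · rw [if_pos h]
          exact (hsub _ (Finset.mem_filter.mp (hm _ h)).1).1
        · rw [if_neg h]
  · intro 𝒩 𝒩' A h
    dsimp only
    rw [h]

end Summit.FinalStateConjecture.FinalStateConjecture.Theorems.SublinearIsFree.Virial

end
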